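import Mathlib
import Literature.Analysis.Complex.PositiveKernelContinuation
import Literature.Analysis.Complex.PositiveKernelPolydisc
import HarnessLib

/-!
# Cauchy–Schwarz across the light-cone tube for kernels positive at Euclidean points

Topic `Literature/Analysis/Complex`.  The scalar shadow of the fact that the holomorphic extension
`e^{-τH + iσP}` (`|Im σ| < Re τ`) of a positive contraction semigroup `e^{-tH}` commuting with a
unitary group `e^{isP}` is a family of CONTRACTIONS once the joint spectrum lies in the cone
`|P| ≤ H` — obtained here without operators, by V. Glaser's propagation of positivity under
analytic continuation (`Literature.Analysis.Complex.isPosSemidefKernelOn_halfPlane_of_ofReal`).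

Setting (`norm_sq_le_re_mul_re_of_tube`): a family `B c d : ℂ × ℂ → ℂ` of functions indexed by
labels `c, d : V` ("vectors"), each holomorphic on the tube `T = {(τ, σ) : |Im σ| < Re τ}`, whose
values at the Euclidean points are a positive-semidefinite Gram kernel in the sense
`∑_{ab} γ̄_a γ_b B (c_a) (c_b) (t_a + t_b, s_b - s_a) ≥ 0` (`t_a > 0`, `s_a ∈ ℝ`) — as for
`B c d (t, s) = ⟪ψ_c, e^{-tH} e^{isP} ψ_d⟫`.  Conclusion: for every `(τ, σ) ∈ T`,

  `‖B c d (τ, σ)‖² ≤ Re B c c (Re τ, i Im σ) · Re B d d (Re τ, i Im σ)`.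

Proof: the kernel `𝒦((c, τ₁, σ₁), (d, τ₂, σ₂)) = B c d (τ̄₁ + τ₂, σ₂ - σ̄₁)` (formally
`⟪e^{-τ₁H+iσ₁P}ψ_c, e^{-τ₂H+iσ₂P}ψ_d⟫`) is positive-semidefinite at real points; Glaser's lemma in
the variable `τ` (right half-plane, real parameter `s`) and then in the variable `σ` (strip
`|Im σ| < r` transported to the right half-plane by `σ = (2r/π) log w`, parameters `(c, τ)` with
`Re τ ≥ r`) makes it positive-semidefinite at complex points; the `2 × 2` case at the points
`(c, τ̄/2, -σ̄/2)`, `(d, τ/2, σ/2)` is the inequality.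

NOT here: Hilbert spaces, operators, spectral measures (the consumer feeds in
`B c c (t, iβ) = ∫ e^{-tE-βp} dμ_c ≤ ‖ψ_c‖²`).  Everything is folklore given Glaser (1974).

## References
* V. Glaser, *On the equivalence of the Euclidean and Wightman formulation of field theory*,
  Comm. Math. Phys. 37 (1974) 257–272, §2. [folklore]
* J. Glimm, A. Jaffe, *Quantum Physics* (2nd ed. 1987), §19.5 (contractions `e^{-τH+iσP}`). [folklore]
-/

noncomputable section

open _root_.Complex Set Filter Metric
open scoped _root_.Topology ComplexOrder ComplexConjugate BigOperators

namespace Literature.Analysis.Complex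

/-! ### The `2 × 2` case of positive-semidefiniteness -/

/-- A positive-semidefinite `2 × 2` complex "matrix" `(a b; c d)` (in the sense
`γ̄₁γ₁ a + γ̄₁γ₂ b + γ̄₂γ₁ c + γ̄₂γ₂ d ≥ 0` for all `γ`) satisfies `|b|² ≤ Re a · Re d`. [folklore] -/
theorem norm_sq_le_of_psd_two {a b c d : ℂ}
    (h : ∀ γ₁ γ₂ : ℂ, 0 ≤ conj γ₁ * γ₁ * a + conj γ₁ * γ₂ * b + conj γ₂ * γ₁ * c + conj γ₂ * γ₂ * d) :
    ‖b‖ ^ 2 ≤ a.re * d.re := by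
  have ha := h 1 0
  have hd := h 0 1
  have h11 := h 1 1
  have h1I := h 1 I
  simp only [map_one, one_mul, map_zero, zero_mul, mul_zero, add_zero, zero_add, mul_one] at ha hd h11 h1I
  rw [Complex.nonneg_iff] at ha hd h11 h1I
  obtain ⟨ha_re, ha_im⟩ := ha
  obtain ⟨hd_re, hd_im⟩ := hd
  -- `c = conj b`
  have hc_im : c.im = -b.im := by
    have := h11.2
    simp only [add_im] at this
    linarith
  have hc_re : c.re = b.re := by
    have := h1I.2
    simp only [add_im, mul_im, conj_re, conj_im, I_re, I_im, mul_re] at this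
    nlinarith
  have hbc : b * c = ((‖b‖ ^ 2 : ℝ) : ℂ) := by
    have : c = conj b := Complex.ext (by simp [hc_re]) (by simp [hc_im])
    rw [this, Complex.mul_conj, Complex.normSq_eq_norm_sq]
  -- the discriminant family `γ = (1, -t conj b)`
  have hfam : ∀ t : ℝ, 0 ≤ a.re - 2 * t * ‖b‖ ^ 2 + t ^ 2 * ‖b‖ ^ 2 * d.re := by
    intro t
    have ht := (Complex.nonneg_iff.1 (h 1 (-(t : ℂ) * conj b))).1
    have e : conj (1 : ℂ) * 1 * a + conj (1 : ℂ) * (-(t : ℂ) * conj b) * b +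
        conj (-(t : ℂ) * conj b) * 1 * c + conj (-(t : ℂ) * conj b) * (-(t : ℂ) * conj b) * d =
        a - (t : ℂ) * ((‖b‖ ^ 2 : ℝ) : ℂ) - (t : ℂ) * ((‖b‖ ^ 2 : ℝ) : ℂ) +
          (t : ℂ) ^ 2 * ((‖b‖ ^ 2 : ℝ) : ℂ) * d := by
      have e1 : conj b * b = ((‖b‖ ^ 2 : ℝ) : ℂ) := by
        rw [mul_comm, Complex.mul_conj, Complex.normSq_eq_norm_sq]
      simp only [map_one, one_mul, map_mul, map_neg, Complex.conj_ofReal, Complex.conj_conj, mul_one]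
      rw [show -(t : ℂ) * conj b * b = -(t : ℂ) * (conj b * b) by ring, e1,
        show -(t : ℂ) * b * c = -(t : ℂ) * (b * c) by ring, hbc,
        show -(t : ℂ) * b * (-(t : ℂ) * conj b) * d = (t : ℂ) ^ 2 * (conj b * b) * d by ring, e1]
      ring
    rw [e] at ht
    have h' : 0 ≤ a.re - t * (‖b‖ * ‖b‖) - t * (‖b‖ * ‖b‖) + t * t * (‖b‖ * ‖b‖) * d.re := by
      simpa [pow_two] using ht
    linarith [h']
  -- conclude
  rcases eq_or_lt_of_le hd_re with hd0 | hdpos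
  · -- `Re d = 0`: then `b = 0`
    rw [← hd0, mul_zero]
    by_contra hcon
    have hcon : 0 < ‖b‖ ^ 2 := lt_of_not_ge hcon
    have hb : ‖b‖ ^ 2 ≠ 0 := hcon.ne'
    have := hfam ((a.re + 1) / (2 * ‖b‖ ^ 2))
    rw [← hd0] at this
    have e : 2 * ((a.re + 1) / (2 * ‖b‖ ^ 2)) * ‖b‖ ^ 2 = a.re + 1 := by
      rw [show 2 * ((a.re + 1) / (2 * ‖b‖ ^ 2)) * ‖b‖ ^ 2 = (a.re + 1) / (2 * ‖b‖ ^ 2) * (2 * ‖b‖ ^ 2) by ring,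
        div_mul_cancel₀ _ (mul_ne_zero two_ne_zero hb)]
    nlinarith
  · have := hfam (1 / d.re)
    have e : a.re - 2 * (1 / d.re) * ‖b‖ ^ 2 + (1 / d.re) ^ 2 * ‖b‖ ^ 2 * d.re =
        a.re - ‖b‖ ^ 2 / d.re := by field_simp; ring
    rw [e, sub_nonneg, div_le_iff₀ hdpos] at this
    linarith

/-- **Cauchy–Schwarz for a positive-semidefinite kernel**: `|K x y|² ≤ Re K(x,x) · Re K(y,y)` for
`x, y ∈ A`. [folklore] -/
theorem IsPosSemidefKernelOn.norm_sq_le {α : Type*} {K : α → α → ℂ} {A : Set α}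
    (h : IsPosSemidefKernelOn K A) {x y : α} (hx : x ∈ A) (hy : y ∈ A) :
    ‖K x y‖ ^ 2 ≤ (K x x).re * (K y y).re := by
  refine norm_sq_le_of_psd_two (c := K y x) fun γ₁ γ₂ => ?_
  have := h 2 ![x, y] (fun i => by fin_cases i <;> simpa) ![γ₁, γ₂]
  simpa [Fin.sum_univ_two, add_assoc] using this

/-! ### The logarithmic chart of a strip -/

/-- The chart `w ↦ κ log w` (`κ` real) of the right half-plane: for `Re w > 0` its imaginary part
is `κ arg w`, of absolute value `< |κ| π/2`... precisely `|Im (κ log w)| ≤ |κ| · |arg w|` with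
`|arg w| < π/2`. [folklore] -/
theorem abs_im_ofReal_mul_log_lt {κ : ℝ} (hκ : 0 < κ) {w : ℂ} (hw : 0 < w.re) :
    |((κ : ℂ) * log w).im| < κ * (Real.pi / 2) := by
  rw [mul_im, ofReal_re, ofReal_im, zero_mul, add_zero, Complex.log_im, abs_mul, abs_of_pos hκ]
  gcongr
  exact Complex.abs_arg_lt_pi_div_two_iff.2 (Or.inl hw)

/-- The chart commutes with conjugation on the right half-plane. [folklore] -/
theorem conj_ofReal_mul_log {κ : ℝ} {w : ℂ} (hw : 0 < w.re) :
    conj ((κ : ℂ) * log w) = (κ : ℂ) * log (conj w) := by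
  rw [map_mul, Complex.conj_ofReal, Complex.log_conj]
  rw [Ne, Complex.arg_eq_pi_iff, not_and_or]
  exact Or.inl (not_lt.2 hw.le)

/-- On the positive reals the chart is real. [folklore] -/
theorem ofReal_mul_log_im_eq_zero (κ : ℝ) {w : ℂ} (hw : 0 < w.re) (hw' : w.im = 0) :
    ((κ : ℂ) * log w).im = 0 := by
  rw [mul_im, ofReal_re, ofReal_im, zero_mul, add_zero, Complex.log_im, Complex.arg_eq_zero_iff.2 ⟨hw.le, hw'⟩,
    mul_zero]

/-- The chart is holomorphic on the right half-plane. [folklore] -/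
theorem differentiableOn_ofReal_mul_log (κ : ℝ) :
    DifferentiableOn ℂ (fun w : ℂ => (κ : ℂ) * log w) {w : ℂ | 0 < w.re} := fun _ hw =>
  ((Complex.differentiableAt_log (Or.inl hw)).const_mul _).differentiableWithinAt

/-- The inverse chart: for `|Im z| < κ π / 2`... precisely, if `|Im (z/κ)| < π/2` then
`w = exp (z / κ)` has `Re w > 0` and `κ log w = z`. [folklore] -/
theorem exp_div_chart {κ : ℝ} (hκ : 0 < κ) {z : ℂ} (hz : |z.im| < κ * (Real.pi / 2)) :
    0 < (exp (z / κ)).re ∧ (κ : ℂ) * log (exp (z / κ)) = z := by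
  have him : (z / κ).im = z.im / κ := by simp [div_ofReal_im]
  have habs : |(z / κ).im| < Real.pi / 2 := by
    rw [him, abs_div, abs_of_pos hκ, div_lt_iff₀ hκ]
    linarith
  refine ⟨?_, ?_⟩
  · rw [Complex.exp_re]
    exact mul_pos (Real.exp_pos _) (Real.cos_pos_of_mem_Ioo ⟨by linarith [(abs_lt.1 habs).1],
      by linarith [(abs_lt.1 habs).2]⟩)
  · rw [Complex.log_exp (by linarith [(abs_lt.1 habs).1, Real.pi_pos]) (by linarith [(abs_lt.1 habs).2, Real.pi_pos])]
    field_simp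

/-! ### The theorem -/

variable {V : Type*}

/-- **Step 1 (Glaser in the time variable).**  For a family `B c d` holomorphic on the tube and
positive-semidefinite at Euclidean points, the kernel
`((c, s), τ₁), ((d, s'), τ₂) ↦ B c d (τ̄₁ + τ₂, s' - s)` (`s, s'` real) is positive-semidefinite on
`(V × ℝ) × {Re τ > 0}`. [folklore] -/
theorem isPosSemidefKernelOn_time (B : V → V → ℂ × ℂ → ℂ)
    (hB : ∀ c d, DifferentiableOn ℂ (B c d) {q : ℂ × ℂ | |q.2.im| < q.1.re})
    (hpos : ∀ (m : ℕ) (c : Fin m → V) (t s : Fin m → ℝ) (γ : Fin m → ℂ), (∀ a, 0 < t a) →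
      0 ≤ ∑ a, ∑ b, conj (γ a) * γ b * B (c a) (c b) (((t a + t b : ℝ) : ℂ), ((s b - s a : ℝ) : ℂ))) :
    IsPosSemidefKernelOn (fun p q : (V × ℝ) × ℂ => B p.1.1 q.1.1 (conj p.2 + q.2, ((q.1.2 - p.1.2 : ℝ) : ℂ)))
      {p | 0 < p.2.re} := by
  refine isPosSemidefKernelOn_halfPlane_of_ofReal
    (k := fun u u' w z => B u.1 u'.1 (w + z, ((u'.2 - u.2 : ℝ) : ℂ))) (fun u u' => ?_)
    (fun _ _ _ _ _ _ => rfl) ?_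
  · refine hasLocalTaylor₂_of_differentiableOn ?_ (isOpen_lt continuous_const Complex.continuous_re)
      (isOpen_lt continuous_const Complex.continuous_re)
    have hmaps : MapsTo (fun q : ℂ × ℂ => (q.1 + q.2, ((u'.2 - u.2 : ℝ) : ℂ)))
        ({w : ℂ | 0 < w.re} ×ˢ {w : ℂ | 0 < w.re}) {q : ℂ × ℂ | |q.2.im| < q.1.re} := by
      intro q hq
      simp only [mem_prod, mem_setOf_eq] at hq
      simp only [mem_setOf_eq, ofReal_im, abs_zero, add_re]
      linarith [hq.1, hq.2]
    exact (hB _ _).comp (by fun_prop) hmaps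
  · intro m P hP γ
    have key : ∀ a b, B (P a).1.1 (P b).1.1 (conj (P a).2 + (P b).2, (((P b).1.2 - (P a).1.2 : ℝ) : ℂ)) =
        B (P a).1.1 (P b).1.1 ((((P a).2.re + (P b).2.re : ℝ) : ℂ), (((P b).1.2 - (P a).1.2 : ℝ) : ℂ)) := by
      intro a b
      congr 2
      apply Complex.ext <;> simp [(hP a).2, (hP b).2]
    simp_rw [key]
    exact hpos m (fun a => (P a).1.1) (fun a => (P a).2.re) (fun a => (P a).1.2) γ fun a => (hP a).1

/-- **Step 2 (Glaser in the space variable, on a strip).**  With `r > 0` and the chart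
`σ = κ log w`, `κ = 2r/π`, the kernel
`((c, τ₁), w₁), ((d, τ₂), w₂) ↦ B c d (τ̄₁ + τ₂, κ log w₂ - conj (κ log w₁))` (`Re τᵢ ≥ r`) is
positive-semidefinite on `(V × {Re τ ≥ r}) × {Re w > 0}`. [folklore] -/
theorem isPosSemidefKernelOn_space (B : V → V → ℂ × ℂ → ℂ)
    (hB : ∀ c d, DifferentiableOn ℂ (B c d) {q : ℂ × ℂ | |q.2.im| < q.1.re})
    (hpos : ∀ (m : ℕ) (c : Fin m → V) (t s : Fin m → ℝ) (γ : Fin m → ℂ), (∀ a, 0 < t a) →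
      0 ≤ ∑ a, ∑ b, conj (γ a) * γ b * B (c a) (c b) (((t a + t b : ℝ) : ℂ), ((s b - s a : ℝ) : ℂ)))
    {r : ℝ} (hr : 0 < r) :
    IsPosSemidefKernelOn (fun p q : (V × {z : ℂ // r ≤ z.re}) × ℂ =>
      B p.1.1 q.1.1 (conj (p.1.2 : ℂ) + q.1.2,
        ((2 * r / Real.pi : ℝ) : ℂ) * log q.2 - conj (((2 * r / Real.pi : ℝ) : ℂ) * log p.2)))
      {p | 0 < p.2.re} := by
  set κ : ℝ := 2 * r / Real.pi with hκ
  have hκ0 : 0 < κ := by positivity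
  have hκπ : κ * (Real.pi / 2) = r := by rw [hκ]; field_simp
  refine isPosSemidefKernelOn_halfPlane_of_ofReal
    (k := fun u u' a b => B u.1 u'.1 (conj (u.2 : ℂ) + u'.2, (κ : ℂ) * log b - (κ : ℂ) * log a))
    (fun u u' => ?_) (fun u u' s s' hs _ => by simp only [conj_ofReal_mul_log hs]) ?_
  · -- bounded double Taylor expansions from joint holomorphy on `Π × Π`
    refine hasLocalTaylor₂_of_differentiableOn ?_ (isOpen_lt continuous_const Complex.continuous_re)
      (isOpen_lt continuous_const Complex.continuous_re)
    have hmaps : MapsTo (fun q : ℂ × ℂ => (conj (u.2 : ℂ) + u'.2, (κ : ℂ) * log q.2 - (κ : ℂ) * log q.1))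
        ({w : ℂ | 0 < w.re} ×ˢ {w : ℂ | 0 < w.re}) {q : ℂ × ℂ | |q.2.im| < q.1.re} := by
      intro q hq
      simp only [mem_prod, mem_setOf_eq] at hq
      simp only [mem_setOf_eq, sub_im, add_re, conj_re]
      have h1 := abs_im_ofReal_mul_log_lt hκ0 hq.1
      have h2 := abs_im_ofReal_mul_log_lt hκ0 hq.2
      rw [hκπ] at h1 h2
      have := u.2.2
      have := u'.2.2
      refine (abs_sub _ _).trans_lt ?_
      linarith
    refine (hB _ _).comp ?_ hmaps
    refine DifferentiableOn.prodMk (differentiableOn_const _) ?_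
    exact ((differentiableOn_ofReal_mul_log κ).comp differentiable_snd.differentiableOn
      (fun q hq => hq.2)).sub ((differentiableOn_ofReal_mul_log κ).comp
      differentiable_fst.differentiableOn (fun q hq => hq.1))
  · -- positivity at real `w`: these are Euclidean points of Step 1
    have h1 := isPosSemidefKernelOn_time B hB hpos
    have h2 := h1.comp (B := {p : (V × {z : ℂ // r ≤ z.re}) × ℂ | 0 < p.2.re ∧ p.2.im = 0})
      (fun p => ((p.1.1, ((κ : ℂ) * log p.2).re), (p.1.2 : ℂ))) (fun p _ => hr.trans_le p.1.2.2)
    refine h2.of_eqOn fun p hp q hq => ?_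
    simp only
    congr 2
    apply Complex.ext
    · simp
    · simp only [sub_im, conj_im, ofReal_im]
      rw [ofReal_mul_log_im_eq_zero κ hp.1 hp.2, ofReal_mul_log_im_eq_zero κ hq.1 hq.2]
      simp

/-- **Cauchy–Schwarz across the light-cone tube** (scalar form of "`e^{-τH+iσP}` is a contraction
for `|Im σ| < Re τ` when the joint spectrum lies in the cone `|P| ≤ H`", Glimm–Jaffe §19.5, via
Glaser's positivity propagation).  Let `B c d` (`c, d : V`) be holomorphic on the tube
`{|Im σ| < Re τ}` and positive-semidefinite at Euclidean points:
`∑_{ab} γ̄_a γ_b B (c_a) (c_b) (t_a + t_b, s_b - s_a) ≥ 0` for `t_a > 0`, `s_a ∈ ℝ`.  Then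
`‖B c d (τ, σ)‖² ≤ Re B c c (Re τ, i Im σ) · Re B d d (Re τ, i Im σ)` on the tube. [folklore] -/
theorem norm_sq_le_re_mul_re_of_tube (B : V → V → ℂ × ℂ → ℂ)
    (hB : ∀ c d, DifferentiableOn ℂ (B c d) {q : ℂ × ℂ | |q.2.im| < q.1.re})
    (hpos : ∀ (m : ℕ) (c : Fin m → V) (t s : Fin m → ℝ) (γ : Fin m → ℂ), (∀ a, 0 < t a) →
      0 ≤ ∑ a, ∑ b, conj (γ a) * γ b * B (c a) (c b) (((t a + t b : ℝ) : ℂ), ((s b - s a : ℝ) : ℂ)))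
    (c d : V) {τ σ : ℂ} (hτσ : |σ.im| < τ.re) :
    ‖B c d (τ, σ)‖ ^ 2 ≤
      (B c c ((τ.re : ℂ), (σ.im : ℂ) * I)).re * (B d d ((τ.re : ℂ), (σ.im : ℂ) * I)).re := by
  -- the half-width `r = Re τ / 2`
  set r : ℝ := τ.re / 2 with hr_def
  have hτ : 0 < τ.re := (abs_nonneg _).trans_lt hτσ
  have hr : 0 < r := by positivity
  set κ : ℝ := 2 * r / Real.pi with hκ
  have hκ0 : 0 < κ := by positivity
  have hκπ : κ * (Real.pi / 2) = r := by rw [hκ]; field_simp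
  have hK := isPosSemidefKernelOn_space B hB hpos hr
  -- the two points
  have hτ1 : r ≤ (conj τ / 2).re := by simp [hr_def]
  have hτ2 : r ≤ (τ / 2).re := by simp [hr_def]
  have hσ1 : |(-(conj σ) / 2).im| < κ * (Real.pi / 2) := by
    rw [hκπ, hr_def]; simp [abs_div]; linarith
  have hσ2 : |(σ / 2).im| < κ * (Real.pi / 2) := by
    rw [hκπ, hr_def]; simp [abs_div]; linarith
  obtain ⟨hw1, hlog1⟩ := exp_div_chart hκ0 hσ1
  obtain ⟨hw2, hlog2⟩ := exp_div_chart hκ0 hσ2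
  set P₁ : (V × {z : ℂ // r ≤ z.re}) × ℂ := ((c, ⟨conj τ / 2, hτ1⟩), exp (-(conj σ) / 2 / κ)) with hP₁
  set P₂ : (V × {z : ℂ // r ≤ z.re}) × ℂ := ((d, ⟨τ / 2, hτ2⟩), exp (σ / 2 / κ)) with hP₂
  have hCS := hK.norm_sq_le (x := P₁) (y := P₂) hw1 hw2
  simp only [hP₁, hP₂] at hCS
  rw [hlog1, hlog2] at hCS
  -- identify the three values
  have e12 : (conj (conj τ / 2) + τ / 2, σ / 2 - conj (-conj σ / 2)) = (τ, σ) := by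
    ext1
    · simp only [map_div₀, Complex.conj_conj]; rw [map_ofNat]; ring
    · simp only [map_div₀, map_neg, Complex.conj_conj]; rw [map_ofNat]; ring
  have e11 : (conj (conj τ / 2) + conj τ / 2, -conj σ / 2 - conj (-conj σ / 2)) =
      ((τ.re : ℂ), (σ.im : ℂ) * I) := by
    ext1
    · simp only [map_div₀, Complex.conj_conj]
      rw [map_ofNat, ← add_div, Complex.add_conj]; push_cast; ring
    · simp only [map_div₀, map_neg, Complex.conj_conj]
      rw [map_ofNat, show -conj σ / 2 - -σ / 2 = (σ - conj σ) / 2 by ring,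
        Complex.sub_conj]; push_cast; ring
  have e22 : (conj (τ / 2) + τ / 2, σ / 2 - conj (σ / 2)) = ((τ.re : ℂ), (σ.im : ℂ) * I) := by
    ext1
    · simp only [map_div₀]
      rw [map_ofNat, ← add_div, add_comm, Complex.add_conj]; push_cast; ring
    · simp only [map_div₀]
      rw [map_ofNat, ← sub_div, Complex.sub_conj]; push_cast; ring
  rw [e12, e11, e22] at hCS
  exact hCS

end Literature.Analysis.Complex
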